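import Summits.QuantumFields.YangMills.Theorems.BalabanUVNodesN07HalvingStepTopOfLocalLetters
import Literature.MathematicalPhysics.QuantumFieldTheory.Balaban1983to89.Node00.CriticalOnFibreTopCore

/-!
# BalabanUVNodes ∕ N07 — [15] SECT. F's LAST TWO SENTENCES AT THE OBJECTS OF RECORD, CORE FORM: the per-plaquette ∕ per-bond local-gauge tokens of
# `…N07HalvingStepTopOfLocalLetters` ((167)-letters and (165)-letters) RESTRICTED to where print's analysis acts — plaquettes with a bond inside `Ω₁`, bonds whose
# co-divergence stencil meets `Ω₁` (k0-s1-w3's `HalvingStepTopCore` restriction VERBATIM) — and the closers `… ⇒ HalvingStepTopCore F N Sup B₃ a₀ a₁`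

Cell `pub-ymgap`, width seat `pub-ymgap-dag-n07-w4` (director-ym №197 ∕ HUMAN RULING D-0149), node N07 = [15] = [Balaban1985Variational]; [6] = [Balaban1985RegularSpaces];
sub-target S6 of plan's `W-SEAT-START-LIST.md` v3∕v4 § n07, INTENT-2′ of 2026-08-27.  NEW Theorems-side leaf (`--supports stmt-QuantumFields-20542 --as helper`); CONSUMED BY
NAME, nothing modified: this seat's `…N07HalvingStepTopOfLocalLetters` (p584895: `LocalLetters167TopStep`, `LocalLetters165TopStep`, `radius_descend`, `threshold167_of_budget165`),
k0-s1-w3's `Node00.CriticalOnFibreTopCore` (p585451: `HalvingStepTopCore`), n07-e's module 33c `Node00.LocalGaugeCoDivergence` (`Sect2.regularTwo_of_localGauge10On`), def-P11's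
`Sect2.printedPlaqs`, 33b's `Sect2.bondsDeep`.

WHY.  Print's one-step improvement (p. 304: *«The cube Δ₀ is an arbitrary cube Δ(y) = B^j(y), if y ∈ Λ_j, hence U_k belongs to the space (2) with max{B₃ε₁, ½ε₀} instead of
ε₀»*) runs its ANALYSIS — the gauge (152), the equation (158), the bounds (160)–(167) — around unit cubes of the levels `j ≥ 1`; on the record's top-domain reading the
class (2) also has PURE-DATA members at level `0` (plaquettes all of whose bonds are pinned to the datum `W₀`, bonds whose whole stencil lies off `Ω₁`), where (2) is (7)
directly.  k0-s1-w3 NAMED the genuine obligation `HalvingStepTopCore` (conclusion asked only at `p ∉ Sect2.printedPlaqs s.Ω k 0`, `b ∉ Sect2.bondsDeep (s.Ω 1)ᶜ`) and lands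
`HalvingStepTopCore ⇒ HalvingStepTop` from the data bookkeeping Summits-side (`…K0HalvingStepOfCore`, their INTENT-2).  THIS FILE restricts the S6 interface the same way,
so that the Sect.-F suppliers (sub-targets S3–S5) owe the (165)-letters in a local gauge ONLY around the core plaquettes ∕ bonds — never a gauge of the pinned datum.

CONTENTS.  §1 ★★ `LocalLetters167TopStepCore F N Sup B₃ a₀ a₁` (def: `LocalLetters167TopStep`'s binder block BYTE FOR BYTE, conclusion Core-restricted; NEVER asserted),
`localLetters167Core_of_localLetters167` (restriction), `.of_le`, ★ `halvingStepTopCore_of_localLetters167Core`.  §2 ★★ `LocalLetters165TopStepCore F N Sup B₃ C θ Q a₀ a₁` (def; NEVER asserted),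
`localLetters165Core_of_localLetters165`, `.of_le`, `localLetters167Core_of_localLetters165Core`, ★ `halvingStepTopCore_of_localLetters165Core`.

HONEST FRAMING: two displayed `Prop`s (never asserted) + kernel bookkeeping (p584895's §2–§3 with one extra hypothesis threaded); NOTHING of Bałaban's analysis is
proved; the tokens are NOT discharged (A6: LOCATED — antecedent = the token; binder block = `HalvingStepTop`'s, inhabited by n07-e's `…N07Prop8StepFlatWitness`);
`stub_prop8StepCoP13` ∕ K0⁷ ∕ K1⁷ NOT closed; N07 NOT discharged; counts unmoved (28∕28 · 5∕27); one finite T⁴ programme at fixed ε — R4 closes the conditional rung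
`BalabanLadder.UV` only, never the summit: NOT continuum ∕ ℝ⁴ ∕ OS ∕ mass gap ∕ Clay.  Two `def`s, no `instance`∕`notation`∕`sorry`.
-/

noncomputable section

namespace Summit.QuantumFields.YangMills.BalabanUVNodes.N07HalvingStepTopCoreOfLocalLetters

open scoped Matrix.Norms.L2Operator
open Literature.MathematicalPhysics.QuantumFieldTheory.Balaban1983to89
open Literature.MathematicalPhysics.QuantumFieldTheory.Balaban1983to89.Node00
open Literature.MathematicalPhysics.QuantumFieldTheory.Balaban1983to89.T4Continuum (T4Family)
open Literature.MathematicalPhysics.QuantumFieldTheory.Balaban1983to89.B15DeterminingSets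
open Summit.QuantumFields.YangMills.BalabanUVNodes.N07HalvingStepTopOfLocalLetters

/-! ## §0  Plumbing -/

section Eta

variable (P : Params)

/-- `0 < η_i ≤ 1` (`η_i = L^{−i}`, `L ≥ 1`). [cite: Balaban1987RG1, (1.1) p.260 (bookkeeping)] -/
private theorem eta_pos_le_one' (i : ℕ) : 0 < P.eta i ∧ P.eta i ≤ 1 := by
  have hL : (1 : ℝ) ≤ P.L := by exact_mod_cast P.L_pos
  unfold Params.eta
  exact ⟨pow_pos (inv_pos.mpr (lt_of_lt_of_le one_pos hL)) i, pow_le_one₀ (inv_nonneg.mpr (zero_le_one.trans hL)) (inv_le_one_of_one_le₀ hL)⟩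

/-- `32·t ≤ max{…}`, `2·t ≤ max{…}` and the side condition `32·d·t ≤ 1` of the tree's (168), from `64·t ≤ max{B₃δ_i, ½ε_i} ≤ ε_i ≤ a₀ ≤ ½` at `d = 4`.
[cite: Balaban1985Variational, (166)–(168) p.304 (bookkeeping)] -/
private theorem thresholds168' {d : ℕ} (hd : d = 4) {B₃ δi εi a₀ t : ℝ} (hB₃ : 0 ≤ B₃) (hδi : 0 < δi) (hε : B₃ * δi ≤ εi ∧ εi ≤ a₀)
    (ha₀ : 2 * a₀ ≤ 1) (ht : 64 * t ≤ max (B₃ * δi) (εi / 2)) :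
    32 * (d : ℝ) * t ≤ 1 ∧ 32 * t ≤ max (B₃ * δi) (εi / 2) ∧ 2 * t ≤ max (B₃ * δi) (εi / 2) := by
  have hr0 : 0 ≤ max (B₃ * δi) (εi / 2) := le_max_of_le_left (mul_nonneg hB₃ hδi.le)
  have hε0 : 0 ≤ εi := (mul_nonneg hB₃ hδi.le).trans hε.1
  have hrε : max (B₃ * δi) (εi / 2) ≤ εi := max_le hε.1 (by linarith)
  subst hd
  push_cast
  by_cases h0 : 0 ≤ t
  · exact ⟨by linarith [hε.2], by linarith, by linarith⟩
  · have h0' : t < 0 := lt_of_not_ge h0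
    exact ⟨by linarith, by linarith, by linarith⟩

end Eta

/-! ## §1  ★★ The Core-restricted (167)-token and its closer -/

section Token167Core

variable (F : T4Family) (N : ℕ) [NeZero N]

/-- ★★ **[15] (167) IN A LOCAL GAUGE AROUND EVERY CORE PLAQUETTE ∕ BOND OF THE TOP CLASS — TOKEN FORM**: the binder block of `LocalLetters167TopStep F N Sup B₃ a₀ a₁`
(= n07-e's `HalvingStepTop`) BYTE FOR BYTE; the ∃-`Y` ∃-level ∃-`t` local-gauge conclusion (`p ∈ plaqInside Y` ∕ `b ∈ Sect2.bondsDeep Y`, `m ≤ i ≤ k`,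
`64·t ≤ max{B₃δ_i, ½ε_i}`, `Sect2.LocalGauge10On Y η_i t U`) asked ONLY where print's analysis acts (p. 302 «a unit cube Δ₀ ⊂ B_j(Λ_j) containing p or b», `j ≥ 1`):
at plaquettes `p ∉ Sect2.printedPlaqs s.Ω k 0` (a bond of `p` inside `Ω₁`) and bonds `b ∉ Sect2.bondsDeep (s.Ω 1)ᶜ` (stencil meets `Ω₁`) — k0-s1-w3's
`HalvingStepTopCore` restriction VERBATIM.  A `Prop`, NEVER asserted; its discharge is the Sect. F chain at objects (S3–S5 + p584895 §4).
-- TODO(general form): as for `LocalLetters167TopStep` (one ε₁ ∕ ε₀ in print; general `𝔅_k`; (82) tangent criticality).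
[cite: Balaban1985Variational, (167)–(168) p.304, p.302, (7) p.278, Sect. F pp.300–304; Balaban1985RegularSpaces, (1.7)–(1.9) p.77; Balaban1988Convergent, (2.10)–(2.12) p.256] -/
def LocalLetters167TopStepCore (Sup : (ν : Stage7Numerics) → (K : ℕ) → (ℕ → Set (Site (F.P K) 0)) → Set (Site (F.P K) 0)) (B₃ a₀ a₁ : ℝ) : Prop :=
  ∀ (ν : Stage7Numerics) (M : ℕ) (g : ℕ → ℝ) (K k : ℕ) (s : SeqOfRecord F ν M g K k), Sect2.SeqSeparated ν.M₁ s → 0 < ν.M₁ → 1 ≤ k →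
    ∀ (ε δ : ℕ → ℝ),
    (∀ n, n ≤ k → 0 < δ n ∧ δ n ≤ a₁) → (∀ n, n < k → δ n ≤ 2 * δ (n + 1)) → (∀ n, n < k → δ (n + 1) ≤ 2 * δ n) →
    (∀ n, n ≤ k → B₃ * δ n ≤ ε n ∧ ε n ≤ a₀) → (∀ n, n < k → ε n ≤ 2 * ε (n + 1)) → (∀ n, n < k → ε (n + 1) ≤ 2 * ε n) →
    ∀ W : MSField (F.P K) (SU N), Sect2.DataSmall7PTop (avOfRecord F N K) s.Ω (Sup ν K s.Ω) k δ W →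
      ∀ U : GaugeField (F.P K) 0 (SU N),
        (∀ n, n ≤ k → PlaqSmallOn (Sect2.omegaPlaqsTop s.Ω (Sup ν K s.Ω) n) (ε n * (F.P K).eta n ^ 2) U) →
        (∀ n, n ≤ k → Sect2.CoDivSmallOn (Sect2.omegaBondsTop s.Ω (Sup ν K s.Ω) n) (ε n * (F.P K).eta n ^ 3) U) →
        AgreeOn (genSet s.Ω k) (avgFamily (avOfRecord F N K) U) W →
        IsCritOnFibre F N K (genSet s.Ω k) W U →
        ∀ m, m ≤ k →
          (∀ p ∈ Sect2.omegaPlaqsTop s.Ω (Sup ν K s.Ω) m, p ∉ Sect2.printedPlaqs s.Ω k 0 →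
            ∃ (Y : Set (Site (F.P K) 0)) (i : ℕ) (t : ℝ), m ≤ i ∧ i ≤ k ∧ p ∈ plaqInside Y ∧
              64 * t ≤ max (B₃ * δ i) (ε i / 2) ∧ Sect2.LocalGauge10On Y ((F.P K).eta i) t U) ∧
          (∀ b ∈ Sect2.omegaBondsTop s.Ω (Sup ν K s.Ω) m, b ∉ Sect2.bondsDeep (s.Ω 1)ᶜ →
            ∃ (Y : Set (Site (F.P K) 0)) (i : ℕ) (t : ℝ), m ≤ i ∧ i ≤ k ∧ b ∈ Sect2.bondsDeep Y ∧
              64 * t ≤ max (B₃ * δ i) (ε i / 2) ∧ Sect2.LocalGauge10On Y ((F.P K).eta i) t U)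

variable {F N}

/-- The unrestricted token restricts to the core token (forget the pure-data plaquettes ∕ bonds). [cite: Balaban1985Variational, (167) p.304 (bookkeeping)] -/
theorem localLetters167Core_of_localLetters167
    {Sup : (ν : Stage7Numerics) → (K : ℕ) → (ℕ → Set (Site (F.P K) 0)) → Set (Site (F.P K) 0)} {B₃ a₀ a₁ : ℝ}
    (h : LocalLetters167TopStep F N Sup B₃ a₀ a₁) : LocalLetters167TopStepCore F N Sup B₃ a₀ a₁ :=
  fun ν M g K k s hsep hM₁ hk ε δ hδ hcomp hcomp' hε hεcomp hεcomp' W h7 U h17 h19 hfib hcrit m hm =>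
    have ht := h ν M g K k s hsep hM₁ hk ε δ hδ hcomp hcomp' hε hεcomp hεcomp' W h7 U h17 h19 hfib hcrit m hm
    ⟨fun p hp _ => ht.1 p hp, fun b hb _ => ht.2 b hb⟩

/-- The core token is ANTITONE in the ceilings `a₀`, `a₁`. [cite: Balaban1985Variational, (166)–(167) p.304 (bookkeeping)] -/
theorem LocalLetters167TopStepCore.of_le {Sup : (ν : Stage7Numerics) → (K : ℕ) → (ℕ → Set (Site (F.P K) 0)) → Set (Site (F.P K) 0)} {B₃ a₀ a₀' a₁ a₁' : ℝ}
    (h : LocalLetters167TopStepCore F N Sup B₃ a₀ a₁) (ha₀ : a₀' ≤ a₀) (ha₁ : a₁' ≤ a₁) : LocalLetters167TopStepCore F N Sup B₃ a₀' a₁' :=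
  fun ν M g K k s hsep hM₁ hk ε δ hδ hcomp hcomp' hε hεcomp hεcomp' W h7 U h17 h19 hfib hcrit =>
    h ν M g K k s hsep hM₁ hk ε δ (fun n hn => ⟨(hδ n hn).1, (hδ n hn).2.trans ha₁⟩) hcomp hcomp'
      (fun n hn => ⟨(hε n hn).1, (hε n hn).2.trans ha₀⟩) hεcomp hεcomp' W h7 U h17 h19 hfib hcrit

/-- ★ **THE CORE TOKEN CLOSES THE CORE ONE-STEP IMPROVEMENT** (p584895's `halvingStepTop_of_localLetters167` with k0-s1-w3's restriction threaded): for `B₃ ≥ 0`,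
`a₀ ≤ ½`, `LocalLetters167TopStepCore F N Sup B₃ a₀ a₁` gives `HalvingStepTopCore F N Sup B₃ a₀ a₁` — at a core plaquette (resp. bond) the local gauge at unit `η_i`
yields (1.7) at `32·t·η_i²` on `plaqInside Y` and (1.9) at `2·t·η_i³` on `bondsDeep Y` (33c), both below the improved radius at level `i` by `64·t ≤ max{B₃δ_i, ½ε_i}`,
carried to level `m ≤ i` by `radius_descend`.  With k0-s1-w3's Summits sequel `halvingStepTop_of_core` this is «core token ⇒ HalvingStepTop ⇒ stub 1» by name.
[cite: Balaban1985Variational, (167)–(168) p.304, p.302, Prop. 8 p.304; Balaban1985RegularSpaces, (1.7)–(1.9) p.77, (1.54) p.85, Prop. 7 (1.144) p.100] -/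
theorem halvingStepTopCore_of_localLetters167Core {Sup : (ν : Stage7Numerics) → (K : ℕ) → (ℕ → Set (Site (F.P K) 0)) → Set (Site (F.P K) 0)}
    {B₃ a₀ a₁ : ℝ} (h : LocalLetters167TopStepCore F N Sup B₃ a₀ a₁) (hB₃ : 0 ≤ B₃) (ha₀ : 2 * a₀ ≤ 1) :
    HalvingStepTopCore F N Sup B₃ a₀ a₁ := by
  intro ν M g K k s hsep hM₁ hk ε δ hδ hcomp hcomp' hε hεcomp hεcomp' W h7 U h17 h19 hfib hcrit
  have htok := h ν M g K k s hsep hM₁ hk ε δ hδ hcomp hcomp' hε hεcomp hεcomp' W h7 U h17 h19 hfib hcrit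
  have hδpos : ∀ n, n ≤ k → 0 < δ n := fun n hn => (hδ n hn).1
  refine ⟨fun m hm p hp hpc => ?_, fun m hm b hb hbc => ?_⟩
  · obtain ⟨Y, i, t, hmi, hik, hpY, ht, hg⟩ := (htok m hm).1 p hp hpc
    obtain ⟨hd, h32, -⟩ := thresholds168' (T4Family.P_d F K) hB₃ (hδpos i hik) (hε i hik) ha₀ ht
    have hη := eta_pos_le_one' (F.P K) i
    have h1 := (Sect2.regularTwo_of_localGauge10On hg hη.1 hη.2 hd).1 p hpY
    calc dist1 (GaugeField.plaqHol U p) < 32 * t * (F.P K).eta i ^ 2 := h1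
      _ ≤ max (B₃ * δ i) (ε i / 2) * (F.P K).eta i ^ 2 := mul_le_mul_of_nonneg_right h32 (pow_nonneg hη.1.le 2)
      _ ≤ max (B₃ * δ m) (ε m / 2) * (F.P K).eta m ^ 2 := radius_descend (F.P K) hB₃ hδpos hcomp' hεcomp' one_le_two hmi hik
  · obtain ⟨Y, i, t, hmi, hik, hbY, ht, hg⟩ := (htok m hm).2 b hb hbc
    obtain ⟨hd, -, h2⟩ := thresholds168' (T4Family.P_d F K) hB₃ (hδpos i hik) (hε i hik) ha₀ ht
    have hη := eta_pos_le_one' (F.P K) i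
    have h1 := (Sect2.regularTwo_of_localGauge10On hg hη.1 hη.2 hd).2 b hbY
    calc ‖Sect2.coDivSum U b.src b.dir‖ < 2 * t * (F.P K).eta i ^ 3 := h1
      _ ≤ max (B₃ * δ i) (ε i / 2) * (F.P K).eta i ^ 3 := mul_le_mul_of_nonneg_right h2 (pow_nonneg hη.1.le 3)
      _ ≤ max (B₃ * δ m) (ε m / 2) * (F.P K).eta m ^ 3 :=
          radius_descend (F.P K) hB₃ hδpos hcomp' hεcomp' (by norm_num) hmi hik

end Token167Core

/-! ## §2  ★★ The Core-restricted (165)-token, the budget, the closer -/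

section Token165Core

variable (F : T4Family) (N : ℕ) [NeZero N]

/-- ★★ **[15] (165) AT `M_Δ = 1` IN A LOCAL GAUGE AROUND EVERY CORE PLAQUETTE ∕ BOND — TOKEN FORM**: the binder block of `LocalLetters165TopStep F N Sup B₃ C θ Q a₀ a₁`
BYTE FOR BYTE; the ∃-`Y` ∃-level local-gauge conclusion with threshold `C·δ_i + θ·ε_i + Q·ε_i²` (linear in the data threshold — the near part of the `HB` chain
(160)–(161), `C` = «⅛B₃» —, linear in the class radius with the small far-site coefficient `θ` of (161)∕(163), quadratic in it — `Q` = «B₀(C₄ + 4C₂)(36dL²B₁R₁M₁)²» —)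
asked ONLY at the core plaquettes `p ∉ Sect2.printedPlaqs s.Ω k 0` and core bonds `b ∉ Sect2.bondsDeep (s.Ω 1)ᶜ`.  A `Prop`, NEVER asserted — the shape the Sect.-F
suppliers (S3: the gauge equation with `A = A₁ + HB − HD(A₁ + HB)`; S5: `Letters10On Y η_i (C·δ_i + θ·ε_i) HB`; S4: `Letters10On … (Q₁ε_i²) A₁`, `… (Q₂ε_i²) (HD(A₁+HB))`)
deliver through p584895's `localGauge10On_of_eq159`.
[cite: Balaban1985Variational, (159)–(165) pp.303–304, (162)–(163) pp.303–304, p.302, Sect. F pp.300–304; Balaban1985RegularSpaces, (1.7)–(1.9) p.77; Balaban1988Convergent, (2.12) p.256] -/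
def LocalLetters165TopStepCore (Sup : (ν : Stage7Numerics) → (K : ℕ) → (ℕ → Set (Site (F.P K) 0)) → Set (Site (F.P K) 0)) (B₃ C θ Q a₀ a₁ : ℝ) : Prop :=
  ∀ (ν : Stage7Numerics) (M : ℕ) (g : ℕ → ℝ) (K k : ℕ) (s : SeqOfRecord F ν M g K k), Sect2.SeqSeparated ν.M₁ s → 0 < ν.M₁ → 1 ≤ k →
    ∀ (ε δ : ℕ → ℝ),
    (∀ n, n ≤ k → 0 < δ n ∧ δ n ≤ a₁) → (∀ n, n < k → δ n ≤ 2 * δ (n + 1)) → (∀ n, n < k → δ (n + 1) ≤ 2 * δ n) →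
    (∀ n, n ≤ k → B₃ * δ n ≤ ε n ∧ ε n ≤ a₀) → (∀ n, n < k → ε n ≤ 2 * ε (n + 1)) → (∀ n, n < k → ε (n + 1) ≤ 2 * ε n) →
    ∀ W : MSField (F.P K) (SU N), Sect2.DataSmall7PTop (avOfRecord F N K) s.Ω (Sup ν K s.Ω) k δ W →
      ∀ U : GaugeField (F.P K) 0 (SU N),
        (∀ n, n ≤ k → PlaqSmallOn (Sect2.omegaPlaqsTop s.Ω (Sup ν K s.Ω) n) (ε n * (F.P K).eta n ^ 2) U) →
        (∀ n, n ≤ k → Sect2.CoDivSmallOn (Sect2.omegaBondsTop s.Ω (Sup ν K s.Ω) n) (ε n * (F.P K).eta n ^ 3) U) →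
        AgreeOn (genSet s.Ω k) (avgFamily (avOfRecord F N K) U) W →
        IsCritOnFibre F N K (genSet s.Ω k) W U →
        ∀ m, m ≤ k →
          (∀ p ∈ Sect2.omegaPlaqsTop s.Ω (Sup ν K s.Ω) m, p ∉ Sect2.printedPlaqs s.Ω k 0 →
            ∃ (Y : Set (Site (F.P K) 0)) (i : ℕ), m ≤ i ∧ i ≤ k ∧ p ∈ plaqInside Y ∧
              Sect2.LocalGauge10On Y ((F.P K).eta i) (C * δ i + θ * ε i + Q * ε i ^ 2) U) ∧
          (∀ b ∈ Sect2.omegaBondsTop s.Ω (Sup ν K s.Ω) m, b ∉ Sect2.bondsDeep (s.Ω 1)ᶜ →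
            ∃ (Y : Set (Site (F.P K) 0)) (i : ℕ), m ≤ i ∧ i ≤ k ∧ b ∈ Sect2.bondsDeep Y ∧
              Sect2.LocalGauge10On Y ((F.P K).eta i) (C * δ i + θ * ε i + Q * ε i ^ 2) U)

variable {F N}

/-- The unrestricted (165)-token restricts to the core one. [cite: Balaban1985Variational, (165) p.304 (bookkeeping)] -/
theorem localLetters165Core_of_localLetters165
    {Sup : (ν : Stage7Numerics) → (K : ℕ) → (ℕ → Set (Site (F.P K) 0)) → Set (Site (F.P K) 0)} {B₃ C θ Q a₀ a₁ : ℝ}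
    (h : LocalLetters165TopStep F N Sup B₃ C θ Q a₀ a₁) : LocalLetters165TopStepCore F N Sup B₃ C θ Q a₀ a₁ :=
  fun ν M g K k s hsep hM₁ hk ε δ hδ hcomp hcomp' hε hεcomp hεcomp' W h7 U h17 h19 hfib hcrit m hm =>
    have ht := h ν M g K k s hsep hM₁ hk ε δ hδ hcomp hcomp' hε hεcomp hεcomp' W h7 U h17 h19 hfib hcrit m hm
    ⟨fun p hp _ => ht.1 p hp, fun b hb _ => ht.2 b hb⟩

/-- The core (165)-token is ANTITONE in the ceilings `a₀`, `a₁`. [cite: Balaban1985Variational, (165)–(166) p.304 (bookkeeping)] -/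
theorem LocalLetters165TopStepCore.of_le {Sup : (ν : Stage7Numerics) → (K : ℕ) → (ℕ → Set (Site (F.P K) 0)) → Set (Site (F.P K) 0)}
    {B₃ C θ Q a₀ a₀' a₁ a₁' : ℝ} (h : LocalLetters165TopStepCore F N Sup B₃ C θ Q a₀ a₁) (ha₀ : a₀' ≤ a₀) (ha₁ : a₁' ≤ a₁) :
    LocalLetters165TopStepCore F N Sup B₃ C θ Q a₀' a₁' :=
  fun ν M g K k s hsep hM₁ hk ε δ hδ hcomp hcomp' hε hεcomp hεcomp' W h7 U h17 h19 hfib hcrit =>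
    h ν M g K k s hsep hM₁ hk ε δ (fun n hn => ⟨(hδ n hn).1, (hδ n hn).2.trans ha₁⟩) hcomp hcomp'
      (fun n hn => ⟨(hε n hn).1, (hε n hn).2.trans ha₀⟩) hεcomp hεcomp' W h7 U h17 h19 hfib hcrit

/-- **(165) ⇒ (167), CORE FORM** (p584895's `localLetters167_of_localLetters165` with the restriction threaded; the budget is `threshold167_of_budget165` BY NAME:
`128·C ≤ B₃`, `512·θ ≤ 1`, `0 ≤ Q`, `512·Q·a₀ ≤ 1`). [cite: Balaban1985Variational, (162)–(163) pp.303–304, (165)–(167) p.304] -/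
theorem localLetters167Core_of_localLetters165Core {Sup : (ν : Stage7Numerics) → (K : ℕ) → (ℕ → Set (Site (F.P K) 0)) → Set (Site (F.P K) 0)}
    {B₃ C θ Q a₀ a₁ : ℝ} (h : LocalLetters165TopStepCore F N Sup B₃ C θ Q a₀ a₁) (hB₃ : 0 ≤ B₃) (hC : 128 * C ≤ B₃) (hθ' : 512 * θ ≤ 1)
    (hQ : 0 ≤ Q) (ha : 512 * Q * a₀ ≤ 1) : LocalLetters167TopStepCore F N Sup B₃ a₀ a₁ := by
  intro ν M g K k s hsep hM₁ hk ε δ hδ hcomp hcomp' hε hεcomp hεcomp' W h7 U h17 h19 hfib hcrit m hm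
  have htok := h ν M g K k s hsep hM₁ hk ε δ hδ hcomp hcomp' hε hεcomp hεcomp' W h7 U h17 h19 hfib hcrit m hm
  have hbud : ∀ i, i ≤ k → 64 * (C * δ i + θ * ε i + Q * ε i ^ 2) ≤ max (B₃ * δ i) (ε i / 2) := fun i hi =>
    threshold167_of_budget165 hC hθ' hQ ha (hδ i hi).1 ((mul_nonneg hB₃ (hδ i hi).1.le).trans (hε i hi).1) (hε i hi).2
  refine ⟨fun p hp hpc => ?_, fun b hb hbc => ?_⟩
  · obtain ⟨Y, i, hmi, hik, hpY, hg⟩ := htok.1 p hp hpc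
    exact ⟨Y, i, C * δ i + θ * ε i + Q * ε i ^ 2, hmi, hik, hpY, hbud i hik, hg⟩
  · obtain ⟨Y, i, hmi, hik, hbY, hg⟩ := htok.2 b hb hbc
    exact ⟨Y, i, C * δ i + θ * ε i + Q * ε i ^ 2, hmi, hik, hbY, hbud i hik, hg⟩

/-- ★ **THE CORE (165)-LETTERS CLOSE THE CORE ONE-STEP IMPROVEMENT**: `LocalLetters165TopStepCore F N Sup B₃ C θ Q a₀ a₁` with `B₃ ≥ max{128C, 0}`, `512θ ≤ 1`
(print's (163)), `Q ≥ 0`, `512·Q·a₀ ≤ 1` and `a₀ ≤ ½` (print's «ε₀ ≦ a₅») gives k0-s1-w3's `HalvingStepTopCore F N Sup B₃ a₀ a₁`; with their `halvingStepTop_of_core`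
(`Ω₁ ⊆ Sup`, `2L² ≤ B₃`) and n21-c's socket, stub 1 follows BY NAME from the core (165)-letters alone.  Tokens are HYPOTHESES; an implication between named statements.
[cite: Balaban1985Variational, (159)–(168) pp.303–304, Prop. 8 p.304; Balaban1985RegularSpaces, (1.7)–(1.9) p.77, (1.54) p.85] -/
theorem halvingStepTopCore_of_localLetters165Core {Sup : (ν : Stage7Numerics) → (K : ℕ) → (ℕ → Set (Site (F.P K) 0)) → Set (Site (F.P K) 0)}
    {B₃ C θ Q a₀ a₁ : ℝ} (h : LocalLetters165TopStepCore F N Sup B₃ C θ Q a₀ a₁) (hB₃ : 0 ≤ B₃) (hC : 128 * C ≤ B₃) (hθ' : 512 * θ ≤ 1)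
    (hQ : 0 ≤ Q) (ha : 512 * Q * a₀ ≤ 1) (ha₀ : 2 * a₀ ≤ 1) : HalvingStepTopCore F N Sup B₃ a₀ a₁ :=
  halvingStepTopCore_of_localLetters167Core (localLetters167Core_of_localLetters165Core h hB₃ hC hθ' hQ ha) hB₃ ha₀

end Token165Core

end Summit.QuantumFields.YangMills.BalabanUVNodes.N07HalvingStepTopCoreOfLocalLetters

end
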